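import Mathlib
import Summits.NavierStokesRegularity.NavierStokesRegularity.Theses.QuarterLogPincer
import Literature.Analysis.FluidPDE.ClassicalSolution
import Literature.Analysis.FluidPDE.SelfSimilar
import Literature.Analysis.FluidPDE.ChaeWolfRemovingDSS
import Literature.Analysis.FluidPDE.PineauVicolOneSlice
import Literature.Barriers.NavierStokesRegularity.NearOneDssTypeIExclusion
import Summits.NavierStokesRegularity.NavierStokesRegularity.Theorems.QuarterLogPincerFlatWindowDefs
import Summits.NavierStokesRegularity.NavierStokesRegularity.Theorems.QuarterLogPincerTypeIQuantSubcubicExpFlatWindowSliceDictionary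
import Summits.NavierStokesRegularity.NavierStokesRegularity.Theorems.QuarterLogPincerTypeIQuantSubcubicExpFlatWindowAccelerationBound
import Summits.NavierStokesRegularity.NavierStokesRegularity.Theorems.QuarterLogPincerTypeIQuantSubcubicExpFlatWindowAnnulusPressure
import Summits.NavierStokesRegularity.NavierStokesRegularity.Theorems.QuarterLogPincerTypeIQuantSubcubicExpFlatWindowExplicitWindow

/-!
# Line `flat-window` — DSS-wall rung line filed under crux `QuarterLogPincer.TypeIQuantSubcubicExp`
(stmt-NavierStokesRegularity-24077). Seat ns-idea-7 g4, lens «nearmiss», target «DSS wall».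

**No summit is proved by this line, and it does NOT conclude the crux `TypeIQuantSubcubicExp`.**
It is a rung line on the crux's wall.  The registered skeleton of record for the crux
(`Lines/thin_cascade.lean` v5) has ONE open stub, `stub_thinCascadeLiouville` (S3, the DSS wall,
width 0): every surviving minimal object may be a discretely self-similar (DSS) Type-I ancient
solution with SOME factor `λ > 1`, and the only theorem on that wall is the near-one exclusion
(Chae–Wolf 2017 Thm 1.3 = tree `chaeWolf2017_removing_dss_holds`; barrier
`Literature.Barriers.NavierStokesRegularity.NearOneDssTypeIExclusion`): `λ < λ_*(C₀) ⇒ u ≡ 0`, with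
`λ_*(C₀)` INEFFECTIVE in the tree (compactness, `ChaeWolf.exists_limit`); in print the near-one exclusion IS
QUANTITATIVE (Pineau–Vicol 2026 p. 6: the §6 energy method "is quantitative" and "a slight modification …
recovers" Thm 1.6 = [12]) though no closed formula for the window is displayed, and Thm 1.9 (p. 8, Remark 1.10)
is presented precisely as the no-exact-self-similarity generalisation with hypothesis `‖∂ₛU(·,s̄)‖ ≤ δ₀`, the
Poincaré-in-`s` step being their Lemma 8.1 (v2 correction after critic idea-crit-7, 2026-08-28T11:13Z).  What
print does not do is DERIVE 1.6 from 1.9, nor display the window; this file does both in the kernel, with the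
window `exp(δ₀/2B)` in two effective-in-principle constants (`δ₀(C_u) = K_H⁻¹K₂⁻¹θ_*²/8`, PV p. 83 —
Harnack + CKN constants, not yet chased; `B(C₀)` of the acceleration stub).  The barrier file records that its
two evasion conjuncts — (near-one exclusion) and (one-slice regularity, Pineau–Vicol Thm 1.9 = tree
`pineauVicol2026_oneSlice_regularity_holds`) — are "NOT formally linked".

## The lever (new on this wall): temporal Poincaré flatness of the periodic profile ⟶ one quiet slice

A `λ`-DSS field has a `S = 2 log λ`-periodic similarity profile `U(s,y) = lerayOrbit u s y`
(tree `IsDiscretelySelfSimilar.periodic_lerayOrbit`).  A periodic `C²` curve whose ACCELERATION is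
bounded, `‖∂ₛ²U(·,y)‖ ≤ B`, has VELOCITY at most `B·S` (mean-zero Poincaré / Wirtinger in time,
PROVED below: `periodic_deriv_norm_le`).  Interior parabolic regularity in the envelope class gives such
a `B = B(C₀)` for every Type-I ancient classical solution (stub `stub_accelerationBound`, the
`∂ₛ∇ᵏU ∈ L^∞` bounds of Pineau–Vicol (2.3)/(7.2)).  Hence EVERY time slice of a near-one DSS solution
is `B·2 log λ`-approximately self-similar in exactly the sense (1.17) of the one-slice criterion —
the dictionary `√(−t)((−t)∂ₜu − ½u − ½(x·∇)u) = ∂ₛU` is stub `stub_sliceDictionary` — so Theorem 1.9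
makes the apex `(0,0)` regular, and a DSS field bounded near its apex vanishes identically (zoom-down,
PROVED: `eq_zero_of_dss_of_bounded_apex`).  Window formula:

  `λ_*(C₀) ≥ exp( δ₀(C₀) / (2 B(C₀)) )`,  `δ₀` = the one-slice threshold, `B` = the acceleration bound.

**v3 (2026-08-28, files-only import pass): THE LINE IS STUB-FREE.**  Every obligation and every composition of
v1/v2 was LANDED as a Theorems module by LEAD ns-tc-p1 g4 (`--supports stmt-NavierStokesRegularity-24077 --as
helper`, 0 sorry, standard axioms), in this namespace and with the v2 declaration names: defs p628631
`Theorems/QuarterLogPincerFlatWindowDefs`; S `stub_sliceDictionary` p629490 `…FlatWindowSliceDictionary`;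
M `stub_accelerationBound` p631341 `…FlatWindowAccelerationBound` (PV Lemma 8.1 at α = 0, Literature input
p629279 `PineauVicol2026.exists_norm_sliceDeriv2_le`); M `stub_annulusPressure` p630589
`…FlatWindowAnnulusPressure` (existing `PineauVicolPressureIdentification` / `PineauVicolLerayPressure` by name);
compositions p633176 `…FlatWindowExplicitWindow` (`periodic_deriv_norm_le`, `eq_zero_of_dss_of_bounded_apex`,
`oneSliceThreshold_exists`, `regularApex_of_flat`, `removingDss_window_of`,
`chaeWolf2017_removing_dss_of_flatWindow`, and the rung `removingDss_explicitWindow` UNCONDITIONAL).  This file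
now IMPORTS those five modules and keeps only the two closing lines: the near-one exclusion re-derived through
the one-slice gate (`chaeWolf2017_removing_dss_via_oneSlice`, deduplicated against the Literature fact
`chaeWolf2017_removing_dss_holds` — a SECOND kernel proof of Chae–Wolf Thm 1.3, by a different mechanism) and
the rung restated (`flatWindow_rung`).  Sorries: NONE.

## Bears on
* rung `N6d`/DSS wall of LADDER-NS; crux item stmt-NavierStokesRegularity-24077 via its only open stub
  `stub_thinCascadeLiouville` (the thin object may be DSS; this line makes the excluded window explicit
  and computable: instrument row = compute `B(C₀)` and `δ₀(C₀)`);
* barrier `NearOneDssTypeIExclusion`, scope note "conjuncts NOT formally linked" — linked here.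

## Cheapest falsifier
A `C²` `S`-periodic curve with `‖g''‖ ≤ B` and `‖g'(s)‖ > B·S` would kill the lever — impossible
(`periodic_deriv_norm_le` is proved).  The line dies instead if `stub_accelerationBound` is false AS
TYPED (uniform-in-`(s,y)` bound on `∂ₛ²U` in the envelope class) — instrument: the weighted bounds
(2.3)/(7.2) of Pineau–Vicol give `|∂ₛ∇ᵏU| ≲ (1+|y|)^{-1-k}`; `∂ₛ²U` needs one more s-derivative of the
profile equation, i.e. `C^{4}` interior parabolic bounds — standard (Serrin / NRS 1996 Thm 2) but must be
uniform in the class.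

References: Chae–Wolf 2017 (arXiv:1610.09464) Thm 1.3, §4; Pineau–Vicol 2026 (arXiv:2607.09619)
Thm 1.6, Thm 1.9, Lemma 7.1 (7.2), Lemma 8.1 (8.2) [the Poincaré-in-`s` step in print, used there inside
the weighted energy estimate, not as a slice criterion], §9; Bradshaw–Tsai arXiv:1811.00502 §§3–4
(= Albritton–Barker 2019, the measured-deficit side of the MINT).
-/


noncomputable section

namespace Summit.NavierStokesRegularity.NavierStokesRegularity.Cruxes.TypeIQuantSubcubicExp.FlatWindow

open MeasureTheory Set Function Filter Topology Metric
open Literature.Analysis Literature.Analysis.FluidPDE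

/-! ### v3: everything below the docstring of v2 is now IMPORTED (landed Theorems, same namespace and names) -/

/-- The near-one exclusion (Chae–Wolf 2017 Thm 1.3 = Literature `chaeWolf2017_removing_dss`) re-derived through
the one-slice gate from the three LANDED obligations — stub-free (v3).  A second kernel proof of the barrier's
first conjunct from its second conjunct; not re-landed as a Theorems file (dedup against
`chaeWolf2017_removing_dss_holds`). -/
theorem chaeWolf2017_removing_dss_via_oneSlice : chaeWolf2017_removing_dss :=
  chaeWolf2017_removing_dss_of_flatWindow stub_sliceDictionary stub_accelerationBound
    stub_annulusPressure

/-- **Rung statement of the line (stub-free, = landed `removingDss_explicitWindow`, p633176):** for every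
envelope constant `C₀ > 0` there are a one-slice threshold `δ₀ > 0` and an acceleration bound `B > 0` — both
outputs of quantitative interior estimates, hence instrument targets — such that `λ`-DSS Type-I ancient classical
solutions in the envelope class `HasTypeIDecay C₀` vanish for all `1 < λ ≤ exp(δ₀/(2B))`.  This does NOT
conclude the crux `TypeIQuantSubcubicExp` (24077) and narrows no open stub of `Lines/thin_cascade.lean`
(S3 `stub_thinCascadeLiouville` is every `λ > 1`); no summit is proved. -/
theorem flatWindow_rung :
    ∀ C₀ : ℝ, 0 < C₀ → ∃ δ₀ B : ℝ, 0 < δ₀ ∧ 0 < B ∧ OneSliceThreshold C₀ δ₀ ∧ AccelerationBound C₀ B ∧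
      ∀ c : ℝ, 1 < c → c ≤ Real.exp (δ₀ / (2 * B)) →
        ∀ (u : ℝ → EuclideanSpace ℝ (Fin 3) → EuclideanSpace ℝ (Fin 3))
          (p : ℝ → EuclideanSpace ℝ (Fin 3) → ℝ),
          IsClassicalNSSolutionOn (Iio 0) 1 0 u p → IsDiscretelySelfSimilar c u → HasTypeIDecay C₀ u →
          ∀ t < 0, ∀ x, u t x = 0 :=
  removingDss_explicitWindow

end Summit.NavierStokesRegularity.NavierStokesRegularity.Cruxes.TypeIQuantSubcubicExp.FlatWindow

end
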